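import Summits.Ventures.Crystal3D.Theorems.StickyWulffConstantGenericWallFloorDockedMenuDefs
import Summits.Ventures.Crystal3D.Theorems.StickyWulffConstantGenericWallFloorDockedExactHcp
import HarnessLib

/-!
# `DockedMenu` HOLDS (crux `GenericWallFloor`, stmt-Ventures-19480, line `WallLedgerG`; item (G-c′) of cf-p1 DECISION (xlii′))

HONEST FRAMING. Venture `Summits/Ventures/Crystal3D` (cell `crystal3d-full`), helper `--supports` the crux `GenericWallFloor` of
`route-Ventures-StickyWulffConstant`, REGISTERED line `WallLedgerG`, open stub `stub_twoSlabAdhesion`.  Rung credit only; F-C1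
not moved; NOT the crux.  Pure proof, census-free, standard axioms.

`dockedMenu_holds : DockedMenu` — the named statement of …DockedMenuDefs («docked ⇒ menu»: an end ball docked on a twelve-touched
ball `s` with a close-packed dozen, sharing three linearly independent touching slot neighbours of its grain frame `A`, sees the
grain's slot dozen or one of its eight twin dozens at `s`) is the conjunction of `docked_fcc_exact` (…DockedExact, fcc pattern)
and `docked_hcp_twin` (…DockedExactHcp, hcp pattern).
WHAT THIS IS NOT: nothing new; F-C1 not moved.
-/

noncomputable section

namespace Summit.Ventures.Crystal3D.Theorems

open Literature.Geometry.DiscreteGeometry (fccKissingPattern hcpKissingPattern)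

/-- **`DockedMenu` holds.** -/
theorem dockedMenu_holds : DockedMenu := by
  intro X A z s P B hP hz hall hsz w₁ hw₁ w₂ hw₂ w₃ hw₃ hind hX₁ hX₂ hX₃ hd₁ hd₂ hd₃
  rcases hP with rfl | rfl
  · exact Or.inl (docked_fcc_exact A hz B hall hsz hw₁ hw₂ hw₃ hind hX₁ hX₂ hX₃ hd₁ hd₂ hd₃).1
  · exact Or.inr (docked_hcp_twin A hz B hall hsz hw₁ hw₂ hw₃ hind hX₁ hX₂ hX₃ hd₁ hd₂ hd₃)

end Summit.Ventures.Crystal3D.Theorems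

end
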